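import Mathlib
import Summits.NavierStokesRegularity.NavierStokesRegularity.Theorems.EulerZoomLiouvillePowerGaugeEulerLiouvilleGalileanHarmonicShear
import Summits.NavierStokesRegularity.NavierStokesRegularity.Theorems.EulerZoomLiouvillePowerGaugeEulerLiouvilleGalileanFrameShear
import Summits.NavierStokesRegularity.NavierStokesRegularity.Theorems.EulerZoomLiouvillePowerGaugeEulerLiouvilleGalileanFramePairing
import Literature.Analysis.FluidPDE.WeakSolution
import Literature.Analysis.FluidPDE.DistributionalToWeak
import HarnessLib

/-!
# Crux E `PowerGaugeEulerLiouville` (stmt-NavierStokesRegularity-19832), line `galilean-frames` (ns-idea-11 g6), stub F1e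
# `stub_frameSteadyEscaping`, step (ii): THE FRAME ACCELERATION OF A FRAME-STEADY MEMBER IS WEAKLY A GRADIENT (width seat ns-ezl-w3 g5)

Route №10 `EulerZoomLiouville` (NavierStokesRegularity), crux E.  Lever (L2) of the line `galilean-frames`
(`Cruxes/PowerGaugeEulerLiouville/Lines/galilean_frames.lean`, rev5): distributional bookkeeping for a FRAME-STEADY member
`u(τ, y) = U(y − ξ(τ))` (`τ < T₁ ≤ 0`, `ξ ∈ C¹`, no background; `U, |U|² ∈ L¹_loc`) of a distributional Euler pair on `(−∞,0) × ℝ³`: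

* `integral_tensorTest_frame`, `integral_scalarTensorTest_frame` — the momentum / divergence identities tested with TENSOR fields
  `χ(τ)Φ(y)` read, after the frame shear and Fubini, `∫ (χ' f_Φ + χ N_Φ) dτ = 0` / `∫ χ D_φ dτ = 0`;
* `integral_inner_fderiv_frameVelocity_eq` — for every divergence-free test field `Φ` and EVERY `τ < T₁`,
  `∫ ⟪U, DΦ·ξ'(τ)⟫ = ∫ ⟪U, DΦ·U⟫`: steady Euler in the co-moving frame, `(U·∇)U − (ξ'(τ)·∇)U = −∇q(τ)` weakly;
* `integral_inner_fderiv_frameAcceleration_eq_zero` — hence `∫ ⟪U, DΦ·(ξ'(τ₁) − ξ'(τ₂))⟫ = 0`: the derivative of `U` along every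
  increment of the frame velocity is WEAKLY A GRADIENT — exactly the hypothesis of the line's first lemma
  `GalileanFrames.harmonicShearVanishes` (ns-ezl-w3 g4, p657454);
* `frameProfile_integral_inner_gradient_eq_zero` — the profile `U` is weakly divergence free.

NO co-moving test fields and NO time mollification are needed: for fixed `Φ` the pairing `f_Φ(τ) = ∫⟪U, Φ(· + ξ(τ))⟫` is `C¹` with
derivative `g_Φ(τ) = ∫⟪U, DΦ(· + ξ(τ)) ξ'(τ)⟫` and `N_Φ(τ) = ∫⟪U, DΦ(· + ξ(τ)) U⟫` is continuous (`…GalileanFramePairing`); by parts and the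
fundamental lemma of the calculus of variations give `N_Φ = g_Φ` at every `τ < T₁`, and translating `Φ` by `ξ(τ)` removes the shift.

WHAT THIS IS NOT: not NS regularity, not the crux E, not yet F1e (the affine re-representation and the kill are the companion file
`…GalileanFrameSteady.lean`) — slice identities of one stratum of the crux CLASS 19832 (MODEL lattice; E/NS strata), `--supports` stmt-19832;
19832 OPEN. [folklore; CaffarelliKohnNirenberg1982 §2 (2.1)–(2.2) (distributional form); MajdaBertozzi2002 Prop. 1.1 p. 12 (Galilean frames)]
-/

noncomputable section

-- flat `Theorems/<Route><Decl>…` files of one crux share the namespace of the crux (tree convention: `Summit.<S>.<S>.…`)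
set_option linter.dupNamespace false

open MeasureTheory Set Filter Topology Metric Function TopologicalSpace InnerProductSpace
open scoped ENNReal NNReal RealInnerProductSpace ContDiff

namespace Summit.NavierStokesRegularity.NavierStokesRegularity.Theorems.PowerGaugeEulerLiouville

namespace GalileanFrames

open Literature.Analysis Literature.Analysis.FunctionSpaces Literature.Analysis.FluidPDE
open Summit.NavierStokesRegularity.NavierStokesRegularity.Theorems.PowerGaugeEulerLiouville

variable {U : EuclideanSpace ℝ (Fin 3) → EuclideanSpace ℝ (Fin 3)} {ξ : ℝ → EuclideanSpace ℝ (Fin 3)}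

/-! ### The tested identities of a frame-steady member -/

section Member

variable {u : ℝ → EuclideanSpace ℝ (Fin 3) → EuclideanSpace ℝ (Fin 3)} {p : ℝ → EuclideanSpace ℝ (Fin 3) → ℝ} {T₁ : ℝ}

/-- The divergence of a rescaled field: `div (c • Φ) = c · div Φ`. [folklore] -/
theorem divergence_const_smul {Φ : EuclideanSpace ℝ (Fin 3) → EuclideanSpace ℝ (Fin 3)} (hΦ : Differentiable ℝ Φ) (c : ℝ)
    (x : EuclideanSpace ℝ (Fin 3)) :
    VectorCalculus.divergence (fun y => c • Φ y) x = c * VectorCalculus.divergence Φ x := by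
  unfold VectorCalculus.divergence
  rw [fderiv_fun_const_smul (hΦ x) c, ContinuousLinearMap.toLinearMap_smul, map_smul, smul_eq_mul]

/-- The divergence of a translate is the translate of the divergence. [folklore] -/
theorem divergence_comp_sub (Φ : EuclideanSpace ℝ (Fin 3) → EuclideanSpace ℝ (Fin 3)) (v x : EuclideanSpace ℝ (Fin 3)) :
    VectorCalculus.divergence (fun y => Φ (y - v)) x = VectorCalculus.divergence Φ (x - v) := by
  unfold VectorCalculus.divergence
  rw [fderiv_comp_sub_apply]

/-- **THE MOMENTUM IDENTITY OF A FRAME-STEADY MEMBER, TESTED WITH A TENSOR FIELD** `χ(τ)Φ(y)` (`Φ` divergence free, `χ` supported in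
`(−∞, T₁)`): `∫ (χ'(τ) ∫⟪U, Φ(· + ξ(τ))⟫ + χ(τ) ∫⟪U, DΦ(· + ξ(τ)) U⟫) dτ = 0`. [cite: CaffarelliKohnNirenberg1982, §2 (2.1)–(2.2)] -/
theorem integral_tensorTest_frame
    (hsol : IsDistributionalNSSolutionOn (slab (EuclideanSpace ℝ (Fin 3)) (Iio 0) isOpen_Iio) 0 0 u p)
    (hT₁ : T₁ ≤ 0) (hu : ∀ τ : ℝ, τ < T₁ → u τ = fun y => U (y - ξ τ))
    (hUm : AEStronglyMeasurable U volume) (hU : LocallyIntegrable U volume)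
    (hU2 : LocallyIntegrable (fun z => ‖U z‖ ^ 2) volume) (hξ : Continuous ξ)
    {Φ : EuclideanSpace ℝ (Fin 3) → EuclideanSpace ℝ (Fin 3)} (hΦ : IsTestFunctionOn (⊤ : Opens (EuclideanSpace ℝ (Fin 3))) Φ)
    (hdiv : ∀ z, VectorCalculus.divergence Φ z = 0)
    {χ : ℝ → ℝ} (hχ : ContDiff ℝ (⊤ : ℕ∞) χ) (hχc : HasCompactSupport χ) (hχT : tsupport χ ⊆ Iio T₁) :
    ∫ τ, (deriv χ τ * (∫ z, ⟪U z, Φ (z + ξ τ)⟫) + χ τ * ∫ z, ⟪U z, (fderiv ℝ Φ (z + ξ τ)) (U z)⟫) = 0 := by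
  have hΦc : Continuous Φ := hΦ.contDiff.continuous
  have hΦd : Differentiable ℝ Φ := hΦ.contDiff.differentiable (by simp)
  have hDΦc : Continuous (fderiv ℝ Φ) := hΦ.contDiff.continuous_fderiv (by simp)
  have hDΦs : HasCompactSupport (fderiv ℝ Φ) := hΦ.hasCompactSupport.fderiv (𝕜 := ℝ)
  have hχd : Differentiable ℝ χ := hχ.differentiable (by simp)
  have hχ'c : Continuous (deriv χ) := hχ.continuous_deriv (by simp)
  have hχ0 : ∀ t, T₁ ≤ t → χ t = 0 := fun t ht =>
    image_eq_zero_of_notMem_tsupport fun h => (not_lt.2 ht) (hχT h)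
  have hχ'0 : ∀ t, T₁ ≤ t → deriv χ t = 0 := fun t ht => by
    by_contra hne; exact (not_lt.2 ht) (hχT (support_deriv_subset (mem_support.2 hne)))
  -- the tensor test field and the momentum identity
  have hΨ : IsSpaceTimeTestOn (slab (EuclideanSpace ℝ (Fin 3)) (Iio 0) isOpen_Iio)
      (fun s (x : EuclideanSpace ℝ (Fin 3)) => χ s • Φ x) :=
    isSpaceTimeTestOn_slab_smul isOpen_Iio hχ hχc (hχT.trans (Iio_subset_Iio hT₁)) hΦ
  have id0 := hsol.2.2.2.2 _ hΨ
  -- the frame integrand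
  set F : ℝ → EuclideanSpace ℝ (Fin 3) → ℝ := fun τ z =>
    deriv χ τ * ⟪U z, Φ (z + ξ τ)⟫ + χ τ * ⟪U z, (fderiv ℝ Φ (z + ξ τ)) (U z)⟫ with hF
  have hslab : ((slab (EuclideanSpace ℝ (Fin 3)) (Iio 0) isOpen_Iio : Opens (ℝ × EuclideanSpace ℝ (Fin 3))) :
      Set (ℝ × EuclideanSpace ℝ (Fin 3))) = Iio (0 : ℝ) ×ˢ (univ : Set (EuclideanSpace ℝ (Fin 3))) :=
    coe_slab (X := EuclideanSpace ℝ (Fin 3)) (Iio 0) isOpen_Iio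
  have hFint : ∫ z in Iio (0 : ℝ) ×ˢ (univ : Set (EuclideanSpace ℝ (Fin 3))), F z.1 (z.2 - ξ z.1) = 0 := by
    rw [← hslab]
    refine Eq.trans (setIntegral_congr_fun
      (slab (EuclideanSpace ℝ (Fin 3)) (Iio 0) isOpen_Iio).isOpen.measurableSet fun z _ => ?_) id0
    -- pointwise identification of the integrands
    have hTD : timeDeriv (fun s (x : EuclideanSpace ℝ (Fin 3)) => χ s • Φ x) z.1 z.2 = deriv χ z.1 • Φ z.2 := by
      rw [timeDeriv_apply]; exact deriv_smul_const (hχd z.1) (Φ z.2)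
    have hCV : convect (u z.1) (fun x : EuclideanSpace ℝ (Fin 3) => χ z.1 • Φ x) z.2 =
        χ z.1 • (fderiv ℝ Φ z.2) (u z.1 z.2) := by
      rw [convect_apply, fderiv_fun_const_smul (hΦd z.2) (χ z.1)]
      rfl
    have hDV : VectorCalculus.divergence (fun x : EuclideanSpace ℝ (Fin 3) => χ z.1 • Φ x) z.2 = 0 := by
      rw [divergence_const_smul hΦd, hdiv, mul_zero]
    rw [hTD, hCV, hDV]
    simp only [zero_mul, add_zero, mul_zero, Pi.zero_apply, inner_zero_left, inner_smul_right]
    by_cases ht : z.1 < T₁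
    · rw [hu z.1 ht]
      simp only [hF, sub_add_cancel]
    · simp only [hF, hχ0 z.1 (not_lt.1 ht), hχ'0 z.1 (not_lt.1 ht), zero_mul, add_zero]
  -- integrability of the frame integrand and Fubini
  have hF0 : ∀ τ : ℝ, 0 ≤ τ → ∀ z, F τ z = 0 := fun τ hτ z => by
    simp only [hF, hχ0 τ (hT₁.trans hτ), hχ'0 τ (hT₁.trans hτ), zero_mul, add_zero]
  have hFi : Integrable (uncurry F) ((volume : Measure ℝ).prod (volume : Measure (EuclideanSpace ℝ (Fin 3)))) := by
    have i1 := integrable_frame_linear hU hξ hχ'c hχc.deriv hΦc hΦ.hasCompactSupport (ξ := ξ)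
    have i2 := integrable_frame_quadratic hUm hU2 hξ hχ.continuous hχc hDΦc hDΦs (ξ := ξ)
    exact i1.add i2
  rw [setIntegral_slab_frame_eq hξ.measurable hF0 hFi] at hFint
  -- the inner integrals
  rw [← hFint]
  refine integral_congr_ae (Eventually.of_forall fun τ => ?_)
  have i1 : Integrable (fun z => deriv χ τ * ⟪U z, Φ (z + ξ τ)⟫) volume :=
    (integrable_inner_comp_add hU hΦc hΦ.hasCompactSupport (ξ τ)).const_mul _
  have i2 : Integrable (fun z => χ τ * ⟪U z, (fderiv ℝ Φ (z + ξ τ)) (U z)⟫) volume :=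
    (integrable_inner_clm_comp_add_self hUm hU2 hDΦc hDΦs (ξ τ)).const_mul _
  simp only [hF]
  rw [integral_add i1 i2, integral_const_mul, integral_const_mul]

/-- The gradient field of a scalar test function is a (vector) test field. [folklore] -/
theorem isTestFunctionOn_gradient_field {φ : EuclideanSpace ℝ (Fin 3) → ℝ}
    (hφ : IsTestFunctionOn (⊤ : Opens (EuclideanSpace ℝ (Fin 3))) φ) :
    IsTestFunctionOn (⊤ : Opens (EuclideanSpace ℝ (Fin 3))) (gradient φ) where
  contDiff := by
    refine contDiff_infty.2 fun n => ?_
    exact (InnerProductSpace.toDual ℝ (EuclideanSpace ℝ (Fin 3))).symm.contDiff.comp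
      (hφ.contDiff.fderiv_right (m := n) (by exact_mod_cast le_top))
  hasCompactSupport := (hφ.hasCompactSupport.fderiv (𝕜 := ℝ)).comp_left
    (g := (InnerProductSpace.toDual ℝ (EuclideanSpace ℝ (Fin 3))).symm) (map_zero _)
  tsupport_subset := by simp

/-- The gradient of a rescaled scalar function: `∇(c φ) = c ∇φ`. [folklore] -/
theorem gradient_const_mul {φ : EuclideanSpace ℝ (Fin 3) → ℝ} (hφ : Differentiable ℝ φ) (c : ℝ)
    (x : EuclideanSpace ℝ (Fin 3)) : gradient (fun y => c • φ y) x = c • gradient φ x := by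
  rw [gradient, gradient, fderiv_fun_const_smul (hφ x) c, map_smul]

/-- **THE DIVERGENCE IDENTITY OF A FRAME-STEADY MEMBER, TESTED WITH A TENSOR** `χ(τ)φ(y)`: `∫ χ(τ) (∫⟪U, ∇φ(· + ξ(τ))⟫) dτ = 0`.
[cite: CaffarelliKohnNirenberg1982, §2 (2.1)] -/
theorem integral_scalarTensorTest_frame
    (hsol : IsDistributionalNSSolutionOn (slab (EuclideanSpace ℝ (Fin 3)) (Iio 0) isOpen_Iio) 0 0 u p)
    (hT₁ : T₁ ≤ 0) (hu : ∀ τ : ℝ, τ < T₁ → u τ = fun y => U (y - ξ τ))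
    (hU : LocallyIntegrable U volume) (hξ : Continuous ξ)
    {φ : EuclideanSpace ℝ (Fin 3) → ℝ} (hφ : IsTestFunctionOn (⊤ : Opens (EuclideanSpace ℝ (Fin 3))) φ)
    {χ : ℝ → ℝ} (hχ : ContDiff ℝ (⊤ : ℕ∞) χ) (hχc : HasCompactSupport χ) (hχT : tsupport χ ⊆ Iio T₁) :
    ∫ τ, χ τ * ∫ z, ⟪U z, gradient φ (z + ξ τ)⟫ = 0 := by
  have hG := isTestFunctionOn_gradient_field hφ
  have hφd : Differentiable ℝ φ := hφ.contDiff.differentiable (by simp)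
  have hχ0 : ∀ t, T₁ ≤ t → χ t = 0 := fun t ht =>
    image_eq_zero_of_notMem_tsupport fun h => (not_lt.2 ht) (hχT h)
  have hΘ : IsSpaceTimeTestOn (slab (EuclideanSpace ℝ (Fin 3)) (Iio 0) isOpen_Iio)
      (fun s (x : EuclideanSpace ℝ (Fin 3)) => χ s • φ x) :=
    isSpaceTimeTestOn_slab_smul isOpen_Iio hχ hχc (hχT.trans (Iio_subset_Iio hT₁)) hφ
  have id0 := hsol.2.2.2.1 _ hΘ
  set F : ℝ → EuclideanSpace ℝ (Fin 3) → ℝ := fun τ z => χ τ * ⟪U z, gradient φ (z + ξ τ)⟫ with hF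
  have hslab : ((slab (EuclideanSpace ℝ (Fin 3)) (Iio 0) isOpen_Iio : Opens (ℝ × EuclideanSpace ℝ (Fin 3))) :
      Set (ℝ × EuclideanSpace ℝ (Fin 3))) = Iio (0 : ℝ) ×ˢ (univ : Set (EuclideanSpace ℝ (Fin 3))) :=
    coe_slab (X := EuclideanSpace ℝ (Fin 3)) (Iio 0) isOpen_Iio
  have hFint : ∫ z in Iio (0 : ℝ) ×ˢ (univ : Set (EuclideanSpace ℝ (Fin 3))), F z.1 (z.2 - ξ z.1) = 0 := by
    rw [← hslab]
    refine Eq.trans (setIntegral_congr_fun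
      (slab (EuclideanSpace ℝ (Fin 3)) (Iio 0) isOpen_Iio).isOpen.measurableSet fun z _ => ?_) id0
    have hgr : gradient ((fun s (x : EuclideanSpace ℝ (Fin 3)) => χ s • φ x) z.1) z.2 = χ z.1 • gradient φ z.2 :=
      gradient_const_mul hφd (χ z.1) z.2
    rw [hgr, inner_smul_right]
    by_cases ht : z.1 < T₁
    · rw [hu z.1 ht]
      simp only [hF, sub_add_cancel]
    · simp only [hF, hχ0 z.1 (not_lt.1 ht), zero_mul]
  have hF0 : ∀ τ : ℝ, 0 ≤ τ → ∀ z, F τ z = 0 := fun τ hτ z => by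
    simp only [hF, hχ0 τ (hT₁.trans hτ), zero_mul]
  have hFi : Integrable (uncurry F) ((volume : Measure ℝ).prod (volume : Measure (EuclideanSpace ℝ (Fin 3)))) :=
    integrable_frame_linear hU hξ hχ.continuous hχc hG.contDiff.continuous hG.hasCompactSupport (ξ := ξ)
  rw [setIntegral_slab_frame_eq hξ.measurable hF0 hFi] at hFint
  rw [← hFint]
  refine integral_congr_ae (Eventually.of_forall fun τ => ?_)
  simp only [hF]
  rw [integral_const_mul]

/-- **THE FRAME-VELOCITY IDENTITY (shifted form).**  For a frame-steady member `u(τ) = U(· − ξ(τ))` (`τ < T₁ ≤ 0`, `ξ ∈ C¹`,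
`U, |U|² ∈ L¹_loc`) of a distributional Euler pair and every divergence-free test field `Φ`:
`∫ ⟪U, DΦ(· + ξ(τ)) U⟫ = ∫ ⟪U, DΦ(· + ξ(τ)) ξ'(τ)⟫` at EVERY `τ < T₁`. [folklore] -/
theorem integral_inner_fderiv_comp_add_frameVelocity_eq
    (hsol : IsDistributionalNSSolutionOn (slab (EuclideanSpace ℝ (Fin 3)) (Iio 0) isOpen_Iio) 0 0 u p)
    (hT₁ : T₁ ≤ 0) (hu : ∀ τ : ℝ, τ < T₁ → u τ = fun y => U (y - ξ τ))
    (hUm : AEStronglyMeasurable U volume) (hU : LocallyIntegrable U volume)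
    (hU2 : LocallyIntegrable (fun z => ‖U z‖ ^ 2) volume) (hξ : ContDiff ℝ 1 ξ)
    {Φ : EuclideanSpace ℝ (Fin 3) → EuclideanSpace ℝ (Fin 3)} (hΦ : IsTestFunctionOn (⊤ : Opens (EuclideanSpace ℝ (Fin 3))) Φ)
    (hdiv : ∀ z, VectorCalculus.divergence Φ z = 0) {τ : ℝ} (hτ : τ < T₁) :
    ∫ z, ⟪U z, (fderiv ℝ Φ (z + ξ τ)) (U z)⟫ = ∫ z, ⟪U z, (fderiv ℝ Φ (z + ξ τ)) (deriv ξ τ)⟫ := by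
  have hDΦc : Continuous (fderiv ℝ Φ) := hΦ.contDiff.continuous_fderiv (by simp)
  have hDΦs : HasCompactSupport (fderiv ℝ Φ) := hΦ.hasCompactSupport.fderiv (𝕜 := ℝ)
  exact eq_of_integral_deriv_mul_add_eq_zero
    (f := fun t => ∫ z, ⟪U z, Φ (z + ξ t)⟫)
    (g := fun t => ∫ z, ⟪U z, (fderiv ℝ Φ (z + ξ t)) (deriv ξ t)⟫)
    (N := fun t => ∫ z, ⟪U z, (fderiv ℝ Φ (z + ξ t)) (U z)⟫)
    (fun t => hasDerivAt_integral_inner_comp_add_path hU hξ hΦ t)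
    (continuous_integral_inner_clm_comp_add_path hU hξ.continuous hDΦc hDΦs (hξ.continuous_deriv le_rfl))
    (continuous_integral_inner_clm_comp_add_path_self hUm hU2 hξ.continuous hDΦc hDΦs)
    (fun χ hχ hχc hχT => integral_tensorTest_frame hsol hT₁ hu hUm hU hU2 hξ.continuous hΦ hdiv hχ hχc hχT) hτ

/-- **THE FRAME-VELOCITY IDENTITY.**  For a frame-steady member `u(τ) = U(· − ξ(τ))` (`τ < T₁ ≤ 0`, `ξ ∈ C¹`, `U, |U|² ∈ L¹_loc`) of a
distributional Euler pair on `(−∞,0) × ℝ³` and every divergence-free test field `Φ`, at EVERY `τ < T₁`: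
`∫ ⟪U, DΦ·ξ'(τ)⟫ = ∫ ⟪U, DΦ·U⟫` — the weak form of `(U·∇)U − (ξ'(τ)·∇)U = −∇q(τ)` (steady Euler in the co-moving frame).
[folklore; MajdaBertozzi2002 Prop. 1.1 p. 12] -/
theorem integral_inner_fderiv_frameVelocity_eq
    (hsol : IsDistributionalNSSolutionOn (slab (EuclideanSpace ℝ (Fin 3)) (Iio 0) isOpen_Iio) 0 0 u p)
    (hT₁ : T₁ ≤ 0) (hu : ∀ τ : ℝ, τ < T₁ → u τ = fun y => U (y - ξ τ))
    (hUm : AEStronglyMeasurable U volume) (hU : LocallyIntegrable U volume)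
    (hU2 : LocallyIntegrable (fun z => ‖U z‖ ^ 2) volume) (hξ : ContDiff ℝ 1 ξ)
    {Φ : EuclideanSpace ℝ (Fin 3) → EuclideanSpace ℝ (Fin 3)} (hΦ : IsTestFunctionOn (⊤ : Opens (EuclideanSpace ℝ (Fin 3))) Φ)
    (hdiv : ∀ z, VectorCalculus.divergence Φ z = 0) {τ : ℝ} (hτ : τ < T₁) :
    ∫ z, ⟪U z, (fderiv ℝ Φ z) (deriv ξ τ)⟫ = ∫ z, ⟪U z, (fderiv ℝ Φ z) (U z)⟫ := by
  have hΦ' : IsTestFunctionOn (⊤ : Opens (EuclideanSpace ℝ (Fin 3))) (fun x => Φ (x - ξ τ)) :=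
    isTestFunctionOn_comp_sub hΦ (ξ τ)
  have hdiv' : ∀ z, VectorCalculus.divergence (fun x => Φ (x - ξ τ)) z = 0 := fun z => by
    rw [divergence_comp_sub, hdiv]
  have h := integral_inner_fderiv_comp_add_frameVelocity_eq hsol hT₁ hu hUm hU hU2 hξ hΦ' hdiv' hτ
  simp only [fderiv_comp_sub_apply, add_sub_cancel_right] at h
  exact h.symm

/-- **THE FRAME ACCELERATION IS WEAKLY A GRADIENT.**  For a frame-steady member as above and all `τ₁, τ₂ < T₁`, the directional
derivative of the profile along the frame-velocity increment `e = ξ'(τ₁) − ξ'(τ₂)` is weakly orthogonal to divergence-free test fields: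
`∫ ⟪U, DΦ·(ξ'(τ₁) − ξ'(τ₂))⟫ = 0` — the hypothesis of `GalileanFrames.harmonicShearVanishes` (lever (L2) of line `galilean-frames`). [folklore] -/
theorem integral_inner_fderiv_frameAcceleration_eq_zero
    (hsol : IsDistributionalNSSolutionOn (slab (EuclideanSpace ℝ (Fin 3)) (Iio 0) isOpen_Iio) 0 0 u p)
    (hT₁ : T₁ ≤ 0) (hu : ∀ τ : ℝ, τ < T₁ → u τ = fun y => U (y - ξ τ))
    (hUm : AEStronglyMeasurable U volume) (hU : LocallyIntegrable U volume)
    (hU2 : LocallyIntegrable (fun z => ‖U z‖ ^ 2) volume) (hξ : ContDiff ℝ 1 ξ)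
    {Φ : EuclideanSpace ℝ (Fin 3) → EuclideanSpace ℝ (Fin 3)} (hΦ : IsTestFunctionOn (⊤ : Opens (EuclideanSpace ℝ (Fin 3))) Φ)
    (hdiv : ∀ z, VectorCalculus.divergence Φ z = 0) {τ₁ τ₂ : ℝ} (hτ₁ : τ₁ < T₁) (hτ₂ : τ₂ < T₁) :
    ∫ z, ⟪U z, (fderiv ℝ Φ z) (deriv ξ τ₁ - deriv ξ τ₂)⟫ = 0 := by
  have i : ∀ v : EuclideanSpace ℝ (Fin 3), Integrable (fun z => ⟪U z, (fderiv ℝ Φ z) v⟫) volume := fun v =>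
    integrable_inner_of_locallyIntegrable_of_hasCompactSupport hU
      ((hΦ.contDiff.continuous_fderiv (by simp)).clm_apply continuous_const)
      (hΦ.hasCompactSupport.fderiv_apply (𝕜 := ℝ) v)
  simp_rw [map_sub, inner_sub_right]
  rw [integral_sub (i _) (i _), integral_inner_fderiv_frameVelocity_eq hsol hT₁ hu hUm hU hU2 hξ hΦ hdiv hτ₁,
    integral_inner_fderiv_frameVelocity_eq hsol hT₁ hu hUm hU hU2 hξ hΦ hdiv hτ₂, sub_self]

/-- **THE PROFILE OF A FRAME-STEADY MEMBER IS WEAKLY DIVERGENCE FREE**: `∫ ⟪U, ∇φ⟫ = 0` for every smooth compactly supported `φ`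
(`ξ ∈ C¹`, `U ∈ L¹_loc`, window `τ < T₁ ≤ 0` of positive length below `T₁`). [folklore] -/
theorem frameProfile_integral_inner_gradient_eq_zero
    (hsol : IsDistributionalNSSolutionOn (slab (EuclideanSpace ℝ (Fin 3)) (Iio 0) isOpen_Iio) 0 0 u p)
    (hT₁ : T₁ ≤ 0) (hu : ∀ τ : ℝ, τ < T₁ → u τ = fun y => U (y - ξ τ))
    (hU : LocallyIntegrable U volume) (hξ : ContDiff ℝ 1 ξ)
    {φ : EuclideanSpace ℝ (Fin 3) → ℝ} (hφ : ContDiff ℝ (⊤ : ℕ∞) φ) (hφc : HasCompactSupport φ) :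
    ∫ z, ⟪U z, gradient φ z⟫ = 0 := by
  -- the shifted pairing vanishes at every `τ < T₁`
  have key : ∀ ψ : EuclideanSpace ℝ (Fin 3) → ℝ, IsTestFunctionOn (⊤ : Opens (EuclideanSpace ℝ (Fin 3))) ψ →
      ∀ t, t < T₁ → ∫ z, ⟪U z, gradient ψ (z + ξ t)⟫ = 0 := by
    intro ψ hψ t ht
    have hG := isTestFunctionOn_gradient_field hψ
    have hN : Continuous fun s : ℝ => ∫ z, ⟪U z, gradient ψ (z + ξ s)⟫ :=
      continuous_iff_continuousAt.2 fun s => (hasDerivAt_integral_inner_comp_add_path hU hξ hG s).continuousAt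
    have h := eq_of_integral_deriv_mul_add_eq_zero (f := fun _ => (0 : ℝ)) (g := fun _ => (0 : ℝ))
      (N := fun s => ∫ z, ⟪U z, gradient ψ (z + ξ s)⟫) (fun s => hasDerivAt_const s (0 : ℝ)) continuous_const hN
      (fun χ hχ hχc hχT => by
        simp only [mul_zero, zero_add]
        exact integral_scalarTensorTest_frame hsol hT₁ hu hU hξ.continuous hψ hχ hχc hχT) ht
    exact h
  -- translate the test function by `ξ(T₁ − 1)`
  set t₀ : ℝ := T₁ - 1 with ht₀
  have hφ' : IsTestFunctionOn (⊤ : Opens (EuclideanSpace ℝ (Fin 3))) (fun x => φ (x - ξ t₀)) :=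
    isTestFunctionOn_comp_sub ⟨hφ, hφc, by simp⟩ (ξ t₀)
  have h := key _ hφ' t₀ (by rw [ht₀]; linarith)
  have hgr : ∀ z, gradient (fun x => φ (x - ξ t₀)) (z + ξ t₀) = gradient φ z := fun z => by
    rw [gradient, gradient, fderiv_comp_sub_apply, add_sub_cancel_right]
  simp only [hgr] at h
  exact h

end Member

end GalileanFrames

end Summit.NavierStokesRegularity.NavierStokesRegularity.Theorems.PowerGaugeEulerLiouville
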